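import Mathlib
import Literature.NumberTheory.LFunctions.Zhang2022.TypedSection16ACalM2
import HarnessLib

/-!
# Zhang (2022) §16, (16.9) and §16.u023: the `ω₁`-Mellin representation of `𝒟₂(d,l)` — DISCHARGED

Topic `Literature/NumberTheory/LFunctions/Zhang2022` (Landau–Siegel audit tree; verdict-neutral).
Y. Zhang, *Discrete mean estimates and the Landau–Siegel zero*, arXiv:2211.02515v1 (2022)
[Zhang2022LandauSiegel] — **an unrefereed manuscript under adjudication** (ZHANG-L discharge lane;
DAG nodes `Z22:(16.9)` [Z22 p.91, (16.9), tex L4533] and `Z22:§16.u023` [Z22 p.92, tex L4545],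
typed AS PRINTED as `Typed.Section16A.Eq16_9` and `Typed.Section16A.Step16_u023` in
`Zhang2022/TypedSection16A.lean`; both sit under the v19 leaf `Typed.Section16A.Eq16_12`).

The manuscript (p. 91): "Hence [from u020: `𝒟₂(d,l) = λ₂(d)Σ_n λ̃₂(n,d)ξ₂(n;d,l)g̃₂(dn)/n`],
similar to (15.14), `𝒟₂(d,l) = λ₂(d)·(1/2πi)∫_{(1)} (Σ_n λ̃₂(n,d)ξ₂(n;d,l)/n^{1+s}) P₄^{s+β₂}/d^s ·
ω₁(s+β₂)/(s+β₂) ds + O(ε)` (16.9)", and (p. 92, u023) "Thus we can rewrite `𝒟₂(d,l)` as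
`λ₂(d)·(1/2πi)∫_{(1)} ζ(1+s+β₁)ℳ₂(d,l;1+s)/(ζ(1+s)L(1+s,χ)) · P₄^{s+β₂}/d^s · ω₁(s+β₂)/(s+β₂) ds
+ O(ε)`" (`ε = exp{−c𝓛¹⁰}`, §4 p. 19).

This theorem-only file proves:

* `integrand16_u023_eq_integrand16_9` and the EDGE `step16_u023_of_eq16_9 : Eq16_9 c' →
  Step16_u023 c'` — on the line `Re s = 1` the two integrands coincide, because for `Re(1+s) = 2 > 1`
  the tree theorem `Typed.Section16ACalM2.step16_u021_holds` (u021: `ℳ₂(d,l;w) =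
  ζ(w)L(w,χ)/ζ(w+β₁)·Σ_n λ̃₂ξ₂ n^{−w}`, `Re w > 1`) and the non-vanishing of `ζ`, `L(·,χ)` on
  `Re w = 2` (Mathlib) cancel the normalising quotient.
* `integral_integrand16_9_eq_tsum` — the EXACT `ω₁`-Mellin identity behind (16.9): for `𝓛 > 0`,
  `d ≥ 1`, `(1/2π)∫_ℝ [integrand16_9](1+it) dt = Σ_n λ̃₂(n,d)ξ₂(n;d,l)/n · (dn)^{β₂} g(P₄/(dn))`
  (`g` = the Gaussian-smoothed cutoff (4.1), `Skeleton.gW`): shift `t ↦ t − b₂` (`β₂ = ib₂`,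
  translation invariance of Lebesgue measure), then the tree's
  `GaussWeight.integral_LSeries_mul_kernel` ((2πi)⁻¹∫_{(c)}(Σ aₙn^{−s−w})X^wω₁(w)dw/w = Σ aₙn^{−s}g(X/n))
  at `X = P₄/d`, `c = 1`, `s = −β₂`, coefficients `aₙ = λ̃₂ξ₂(n)/n` (absolutely convergent at
  `Re = 1` by `|λ̃₂ξ₂(n)| ≤ τ(n)⁶`, `Typed.Section16ACalM2.norm_lamTilde2_mul_xi2_le`).
* `gWeight_le_gauss_tail` — GENERIC Gaussian tail of the weight: for `Λ ≥ 24` and `0 < x ≤ 1/2`,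
  `g_Λ(x) ≤ ½·exp(−Λ(log 2)²/2)·x⁸` ((4.3) `GaussWeight.gWeight_le` and
  `Λ log²x ≥ Λ(log 2)²/2 + 8·log(1/x)`).
* `eq16_9_holds : Typed.Section16A.Eq16_9 c'` for every `c′` — **node `Z22:(16.9)` DISCHARGED**
  (with `c = 1`, `D ≥ ⌈e²⌉`; (A) is not used): by u020 (`Typed.Section16ALeaves.step16_u020_holds`)
  and the exact identity, the difference is `λ₂(d)·Σ_{dn ≥ 2P₄} λ̃₂ξ₂(n)/n·(dn)^{β₂}g(P₄/(dn))`
  (`g̃₂(y) = y^{β₂}g*(P₄/y)`, `g* = g·𝟙_{(1/2,∞)}`), of norm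
  `≤ τ(d)²·Σ_{dn≥2P₄} τ(n)⁶/n · ½e^{−𝓛³⁰(log 2)²/2}(P₄/(dn))⁸ ≤ ½(Σ_n τ(n)⁶n⁻⁹)·e^{−𝓛³⁰/5}P₄⁸
  ≤ ½(Σ_n τ(n)⁶n⁻⁹)·exp(−𝓛¹⁰)` (`P₄ ≤ e^{520𝓛⁹}`, `𝓛 ≥ 2`).
* `step16_u023_holds : Typed.Section16A.Step16_u023 c'` — **node `Z22:§16.u023` DISCHARGED**.

No new definitions, no named facts, no `sorry`. Nothing here bears on the later steps of §16
((16.10): the contour shift of the u023 integral), on Theorems 1–2 of the source, or on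
Landau–Siegel zeros.

## References

* Y. Zhang, arXiv:2211.02515v1 (2022), §16 p. 91 (u020, (16.9)), p. 92 (u021, u023); §15 (15.14)
  p. 84; §4 (4.1)–(4.3) p. 19. [cite: Zhang2022LandauSiegel, §16 (16.9) p.91]
-/

noncomputable section

open Complex Real MeasureTheory Filter Topology
open Literature.NumberTheory.LFunctions.Zhang2022
open Literature.NumberTheory.LFunctions.Zhang2022.Skeleton

namespace Literature.NumberTheory.LFunctions.Zhang2022.Typed.Section16A

/-! ## §16.u023 from (16.9): the two integrands agree on `Re s = 1` -/

section EdgeU023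

/-- **The u023 integrand equals the (16.9) integrand on `Re s = 1`**, given u021 at `(d,l)`:
`ζ(2+it+β₁)ℳ₂(d,l;2+it)/(ζ(2+it)L(2+it,χ)) = Σ_n λ̃₂(n,d)ξ₂(n;d,l)n^{−2−it}`, since
`ℳ₂(d,l;w) = ζ(w)L(w,χ)ζ(w+β₁)⁻¹Σ_n λ̃₂ξ₂n^{−w}` for `Re w > 1` and `ζ(w), L(w,χ), ζ(w+β₁) ≠ 0` at
`Re w = 2` (`β₁ ∈ iℝ`). [cite: Zhang2022LandauSiegel, §16 p.92 (u023)] -/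
theorem integrand16_u023_eq_integrand16_9 (c' : ℝ) {D : ℕ} [NeZero D] (χ : DirichletCharacter ℂ D)
    {d l : ℕ} (h21 : ∀ s : ℂ, 1 < s.re → calM2 c' χ d l s = calM2Series c' χ d l s) (t : ℝ) :
    integrand16_u023 c' χ d l (1 + t * I) = integrand16_9 c' χ d l (1 + t * I) := by
  have hre : (1 + (1 + (t : ℂ) * I)).re = 2 := by simp; norm_num
  have h2 : 1 < (1 + (1 + (t : ℂ) * I)).re := by rw [hre]; norm_num
  have hβre : (beta1 c' D).re = 0 := by rw [beta1_eq_b1_mul_I]; simp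
  have hζ : riemannZeta (1 + (1 + t * I)) ≠ 0 := riemannZeta_ne_zero_of_one_lt_re h2
  have hζβ : riemannZeta (1 + (1 + t * I) + beta1 c' D) ≠ 0 :=
    riemannZeta_ne_zero_of_one_lt_re (by rw [Complex.add_re, hre, hβre]; norm_num)
  have hL : χ.LFunction (1 + (1 + t * I)) ≠ 0 := by
    refine DirichletCharacter.LFunction_ne_zero_of_one_le_re χ (Or.inr ?_) (by rw [hre]; norm_num)
    intro h
    have := congrArg Complex.re h
    rw [hre, Complex.one_re] at this
    norm_num at this
  unfold integrand16_u023 integrand16_9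
  rw [h21 _ h2, calM2Series]
  congr 2
  field_simp

/-- **EDGE `Z22:§16.u023 ⇐ Z22:(16.9)`** (same constants `c`, `C`): the two displays have the same
left side `𝒟₂(d,l)` and, by `integrand16_u023_eq_integrand16_9` (u021 is the tree theorem
`Typed.Section16ACalM2.step16_u021_holds`), the same integral. [cite: Zhang2022LandauSiegel, §16 p.92 (u023)] -/
theorem step16_u023_of_eq16_9 (c' : ℝ) (h : Eq16_9 c') : Step16_u023 c' := by
  obtain ⟨c, hc, C, D₉, h9⟩ := h
  obtain ⟨D₁, h21⟩ := Typed.Section16ACalM2.step16_u021_holds c'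
  refine ⟨c, hc, C, max D₉ D₁, fun D _ χ hD hq hp hA d l hd hl hdl => ?_⟩
  have h21' := h21 D χ (le_trans (le_max_right _ _) hD) hq hp d l hd hl
  have e : (∫ t : ℝ, integrand16_u023 c' χ d l (1 + t * I)) =
      ∫ t : ℝ, integrand16_9 c' χ d l (1 + t * I) :=
    integral_congr_ae (Eventually.of_forall fun t =>
      integrand16_u023_eq_integrand16_9 c' χ h21' t)
  rw [e]
  exact h9 D χ (le_trans (le_max_left _ _) hD) hq hp hA d l hd hl hdl

end EdgeU023

/-! ## The exact `ω₁`-Mellin identity behind (16.9) -/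

section MellinIdentity

variable (c' : ℝ) {D : ℕ} [NeZero D] (χ : DirichletCharacter ℂ D)

/-- The coefficients `aₙ = λ̃₂(n,d)ξ₂(n;d,l)/n` are absolutely summable against `n^{−w}` on `Re w = 1`:
`|aₙ n^{−w}| = |λ̃₂ξ₂(n)|/n² ≤ τ(n)⁶/n²` (`Typed.Section16ACalM2.lseriesSummable_lamTilde2_mul_xi2`
at `σ = 2`). [cite: Zhang2022LandauSiegel, §16 p.91 (u021)] -/
theorem lseriesSummable_coeff_div (d l : ℕ) {w : ℂ} (hw : w.re = 1) :
    LSeriesSummable (fun n => lamTilde2 c' χ n d * xi2 c' χ n d l / n) w := by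
  have h2 := Typed.Section16ACalM2.lseriesSummable_lamTilde2_mul_xi2 c' χ d l (s := 2)
    (by norm_num)
  refine Summable.of_norm_bounded h2.norm fun n => le_of_eq ?_
  rcases eq_or_ne n 0 with rfl | hn
  · simp [LSeries.term_zero]
  · have hn0 : 0 < n := Nat.pos_of_ne_zero hn
    simp only [LSeries.term_of_ne_zero hn, norm_div, norm_mul, Complex.norm_natCast_cpow_of_pos hn0,
      hw, Complex.norm_natCast, Real.rpow_one, Complex.re_ofNat, Real.rpow_two]
    ring

omit [NeZero D] in
/-- **The (16.9) integrand after the shift `t ↦ t − b₂`** (`β₂ = ib₂`): at `s = 1 + i(t − b₂)` one has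
`s + β₂ = 1 + it`, `n^{−(1+s)} = n^{−1}·n^{−(−β₂+(1+it))}`, `P₄^{s+β₂}d^{−s} = (P₄/d)^{1+it}d^{β₂}`, so the
integrand is `d^{β₂}·(Σ_n aₙn^{−(−β₂+1+it)})·K_{P₄/d}(t)` with the §4 kernel `K_X(t) = X^{1+it}ω₁(1+it)/(1+it)`
(`GaussWeight.kernel`). [cite: Zhang2022LandauSiegel, §16 (16.9) p.91; §4 p.19] -/
theorem integrand16_9_shift {d : ℕ} (hd : d ≠ 0) (l : ℕ) (hP4 : 0 < P4 D) (t : ℝ) :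
    integrand16_9 c' χ d l (1 + ((t - b2 c' D : ℝ) : ℂ) * I) =
      (d : ℂ) ^ beta2 c' D *
        (LSeries (fun n => lamTilde2 c' χ n d * xi2 c' χ n d l / n)
            (-beta2 c' D + ((1 : ℝ) + t * I)) *
          GaussWeight.kernel (ell D ^ 30) 1 (P4 D / d) t) := by
  have hβ : beta2 c' D = (b2 c' D : ℂ) * I := beta2_eq_b2_mul_I c' D
  -- the shifted point `s = 1 + i(t − b₂)`
  obtain ⟨s, hs⟩ : ∃ s : ℂ, s = 1 + ((t - b2 c' D : ℝ) : ℂ) * I := ⟨_, rfl⟩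
  have hs1 : s + beta2 c' D = 1 + t * I := by rw [hs, hβ]; push_cast; ring
  have hs2 : s = -beta2 c' D + (((1 : ℝ) : ℂ) + t * I) := by rw [hs, hβ]; push_cast; ring
  have hs3 : s = (1 + t * I) - beta2 c' D := by rw [hs, hβ]; push_cast; ring
  have hs0 : 1 + s ≠ 0 := by
    intro h
    have := congrArg Complex.re h
    rw [hs] at this
    simp at this
  have hdC : (d : ℂ) ≠ 0 := Nat.cast_ne_zero.mpr hd
  have hdR : (0 : ℝ) < d := by exact_mod_cast Nat.pos_of_ne_zero hd
  -- the series
  have hser : (∑' n : ℕ, lamTilde2 c' χ n d * xi2 c' χ n d l / (n : ℂ) ^ (1 + s)) =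
      LSeries (fun n => lamTilde2 c' χ n d * xi2 c' χ n d l / n) s := by
    rw [LSeries]
    refine tsum_congr fun n => ?_
    rcases eq_or_ne n 0 with rfl | hn
    · rw [LSeries.term_zero, Nat.cast_zero, Complex.zero_cpow hs0, div_zero]
    · simp only [LSeries.term_of_ne_zero hn]
      rw [Complex.cpow_add _ _ (Nat.cast_ne_zero.mpr hn), Complex.cpow_one, div_div]
  -- the powers
  have hpow : (P4 D : ℂ) ^ (s + beta2 c' D) / (d : ℂ) ^ s =
      ((P4 D / d : ℝ) : ℂ) ^ (1 + (t : ℂ) * I) * (d : ℂ) ^ beta2 c' D := by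
    rw [hs1, hs3, Complex.cpow_sub _ _ hdC, GaussWeight.div_cpow_line hP4 hdR,
      Complex.ofReal_natCast, div_div_eq_mul_div, div_mul_eq_mul_div]
  -- assemble
  rw [← hs, integrand16_9, hser, hpow, hs1, hs2, GaussWeight.kernel]
  push_cast
  ring

/-- **The exact `ω₁`-Mellin identity behind (16.9)**: for `𝓛 > 0` (so `P₄ > 0`) and `d ≥ 1`,
`(1/2π)∫_ℝ [integrand16_9](1+it) dt = Σ_n λ̃₂(n,d)ξ₂(n;d,l)/n · (dn)^{β₂} · g(P₄/(dn))`, `g` the weight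
(4.1) (`Skeleton.gW`): the `t ↦ t − b₂` shift and `GaussWeight.integral_LSeries_mul_kernel` at
`X = P₄/d`, `c = 1`, `s = −β₂`. [cite: Zhang2022LandauSiegel, §16 (16.9) p.91; §4 (4.1) p.19] -/
theorem integral_integrand16_9_eq_tsum {d : ℕ} (hd : d ≠ 0) (l : ℕ) (hℓ : 0 < ell D) :
    (1 / (2 * π) : ℂ) * ∫ t : ℝ, integrand16_9 c' χ d l (1 + t * I) =
      ∑' n : ℕ, lamTilde2 c' χ n d * xi2 c' χ n d l / n *
        (((d * n : ℕ) : ℂ) ^ beta2 c' D * (gW D (P4 D / ((d * n : ℕ) : ℝ)) : ℂ)) := by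
  have hΛ : 0 < ell D ^ 30 := pow_pos hℓ 30
  have hP4 : 0 < P4 D := by
    unfold P4 bigP bigT t0
    positivity
  have hdR : (0 : ℝ) < d := by exact_mod_cast Nat.pos_of_ne_zero hd
  have hX : 0 < P4 D / d := div_pos hP4 hdR
  -- the shift `t ↦ t − b₂`
  have hshift : (∫ t : ℝ, integrand16_9 c' χ d l (1 + t * I)) =
      ∫ t : ℝ, integrand16_9 c' χ d l (1 + ((t - b2 c' D : ℝ) : ℂ) * I) := by
    rw [integral_sub_right_eq_self (fun t : ℝ => integrand16_9 c' χ d l (1 + (t : ℂ) * I))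
      (b2 c' D)]
  -- the kernel identity
  have hsum : LSeriesSummable (fun n => lamTilde2 c' χ n d * xi2 c' χ n d l / n)
      (-beta2 c' D + ((1 : ℝ) : ℂ)) :=
    lseriesSummable_coeff_div c' χ d l (by rw [beta2_eq_b2_mul_I]; simp)
  have hker := GaussWeight.integral_LSeries_mul_kernel hΛ one_pos hX hsum
  rw [hshift]
  simp_rw [integrand16_9_shift c' χ hd l hP4]
  rw [integral_const_mul, ← mul_assoc, mul_comm (1 / (2 * π) : ℂ), mul_assoc, hker,
    ← tsum_mul_left]
  refine tsum_congr fun n => ?_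
  rcases eq_or_ne n 0 with rfl | hn
  · simp [LSeries.term_zero]
  · simp only [LSeries.term_of_ne_zero hn, Complex.cpow_neg, div_inv_eq_mul, Nat.cast_mul,
      Complex.natCast_mul_natCast_cpow, gW, div_div]
    ring

end MellinIdentity

/-! ## The Gaussian tail of the weight `g` -/

section GaussTail

/-- **Gaussian tail of the §4 weight**: for `Λ ≥ 24` (so `Λ·log 2/2 ≥ 8`) and `0 < x ≤ 1/2`,
`g_Λ(x) ≤ ½·exp(−Λ(log 2)²/2)·x⁸` — from (4.3) `g_Λ(x) ≤ ½exp(−Λ log²x)` and, with `u = log(1/x) ≥ log 2`,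
`Λu² ≥ Λ(log 2)²/2 + (Λ log 2/2)u ≥ Λ(log 2)²/2 + 8u`. [cite: Zhang2022LandauSiegel, §4 (4.3) p.19] -/
theorem gWeight_le_gauss_tail {Λ x : ℝ} (hΛ : 24 ≤ Λ) (hx : 0 < x) (hx2 : x ≤ 1 / 2) :
    GaussWeight.gWeight Λ x ≤ 1 / 2 * Real.exp (-(Λ * Real.log 2 ^ 2 / 2)) * x ^ 8 := by
  have hΛ0 : 0 < Λ := by linarith
  have hlog2 : 0.6931471803 < Real.log 2 := Real.log_two_gt_d9
  have hlog2' : Real.log 2 < 0.6931471808 := Real.log_two_lt_d9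
  have hg := GaussWeight.gWeight_le hΛ0 hx (by linarith)
  -- `u = -log x ≥ log 2`
  set u : ℝ := -Real.log x with hu
  have hux : Real.log x = -u := by rw [hu, neg_neg]
  have hu2 : Real.log 2 ≤ u := by
    rw [hu, ← Real.log_inv]
    exact Real.log_le_log (by norm_num) (by rw [le_inv_comm₀ (by norm_num) hx]; linarith)
  have hu0 : 0 ≤ u := le_trans (Real.log_nonneg one_le_two) hu2
  -- the quadratic inequality
  have hquad : Λ * Real.log 2 ^ 2 / 2 + 8 * u ≤ Λ * u ^ 2 := by
    have h1 : 0 ≤ (u - Real.log 2) * (u + Real.log 2 / 2) := mul_nonneg (by linarith) (by linarith)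
    have h2 : 8 * u ≤ Λ * Real.log 2 / 2 * u := by
      have : 8 ≤ Λ * Real.log 2 / 2 := by nlinarith
      exact mul_le_mul_of_nonneg_right this hu0
    nlinarith
  -- `exp(-Λ log² x) ≤ exp(-Λ(log 2)²/2) · x⁸`
  have hx8 : x ^ 8 = Real.exp (-(8 * u)) := by
    have h8 : -(8 * u) = Real.log (x ^ 8) := by
      rw [Real.log_pow, hu]; push_cast; ring
    rw [h8, Real.exp_log (pow_pos hx 8)]
  have hexp : Real.exp (-Λ * Real.log x ^ 2) ≤ Real.exp (-(Λ * Real.log 2 ^ 2 / 2)) * x ^ 8 := by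
    rw [hx8, ← Real.exp_add, Real.exp_le_exp, hux]
    nlinarith
  calc GaussWeight.gWeight Λ x ≤ 1 / 2 * Real.exp (-Λ * Real.log x ^ 2) := hg
    _ ≤ 1 / 2 * (Real.exp (-(Λ * Real.log 2 ^ 2 / 2)) * x ^ 8) :=
        mul_le_mul_of_nonneg_left hexp (by norm_num)
    _ = _ := by ring

end GaussTail

/-! ## (16.9) -/

section Eq169

variable (c' : ℝ)

/-- `|λ₂(d,1)| ≤ τ(d)²` for `d ≥ 1` (`λ₂(d,1) = λ₂(1,1)λ̃₂(d,1) = λ̃₂(d,1)`, `|λ̃₂(n,d′)| ≤ τ(n)²`).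
[cite: Zhang2022LandauSiegel, §16 (16.8) p.91] -/
theorem norm_lam2_one_le {D : ℕ} [NeZero D] (χ : DirichletCharacter ℂ D) {d : ℕ} (hd : d ≠ 0) :
    ‖lam2 c' χ d 1‖ ≤ (d.divisors.card : ℝ) ^ 2 := by
  have h := Typed.Section16ALeaves.lam2_mul_one c' χ one_ne_zero hd
  have h1 : lam2 c' χ 1 1 = 1 := by simp [lam2]
  rw [one_mul, h1, one_mul] at h
  rw [h]
  exact Typed.Section16ACalM2.norm_lamTilde2_le c' χ hd 1

/-- `Σ_n τ(n)⁶ n⁻⁹ < ∞` (`τ(n) ≤ n`, comparison with `Σ n⁻³`). [folklore] -/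
private theorem summable_tau6_div_pow9 :
    Summable fun n : ℕ => (n.divisors.card : ℝ) ^ 6 / (n : ℝ) ^ 9 := by
  refine Summable.of_nonneg_of_le (fun n => by positivity) (fun n => ?_)
    (Real.summable_nat_pow_inv.mpr (by norm_num : 1 < 3))
  rcases Nat.eq_zero_or_pos n with rfl | hn
  · simp
  · have hτ : (n.divisors.card : ℝ) ≤ n := by exact_mod_cast Nat.card_divisors_le_self n
    have hnR : (0 : ℝ) < n := by exact_mod_cast hn
    rw [div_le_iff₀ (by positivity), ← one_div, one_div_mul_eq_div, le_div_iff₀ (by positivity)]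
    calc (n.divisors.card : ℝ) ^ 6 * (n : ℝ) ^ 3 ≤ (n : ℝ) ^ 6 * (n : ℝ) ^ 3 := by gcongr
      _ = (n : ℝ) ^ 9 := by ring

/-- `P₄ ≤ exp(520𝓛⁹)` once `𝓛 ≥ 1` (`P₄ = PT⁻²t₀ ≤ P·t₀ = e^{𝓛⁹}𝓛⁵¹⁹ ≤ e^{𝓛⁹+519𝓛}`).
[cite: Zhang2022LandauSiegel, §6 p.30] -/
private theorem P4_le_exp {D : ℕ} (hℓ : 1 ≤ ell D) : P4 D ≤ Real.exp (520 * ell D ^ 9) := by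
  have hℓ0 : 0 ≤ ell D := by linarith
  have hT : 1 ≤ bigT D := by rw [bigT]; exact Real.one_le_exp (Real.rpow_nonneg hℓ0 _)
  have ht0 : t0 D ≤ Real.exp (519 * ell D) := by
    rw [t0]
    calc ell D ^ 519 ≤ Real.exp (ell D) ^ 519 :=
          pow_le_pow_left₀ hℓ0 (by linarith [Real.add_one_le_exp (ell D)]) 519
      _ = Real.exp (519 * ell D) := by rw [← Real.exp_nat_mul]; norm_num
  have ht0' : 0 ≤ t0 D := by rw [t0]; positivity
  have h9 : ell D ≤ ell D ^ 9 := le_self_pow₀ hℓ (by norm_num)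
  calc P4 D = bigP D / bigT D ^ 2 * t0 D := rfl
    _ ≤ bigP D * t0 D := by
        refine mul_le_mul_of_nonneg_right (div_le_self (Real.exp_pos _).le (one_le_pow₀ hT)) ht0'
    _ ≤ Real.exp (ell D ^ 9) * Real.exp (519 * ell D) :=
        mul_le_mul le_rfl ht0 ht0' (Real.exp_pos _).le
    _ = Real.exp (ell D ^ 9 + 519 * ell D) := by rw [Real.exp_add]
    _ ≤ Real.exp (520 * ell D ^ 9) := Real.exp_le_exp.mpr (by nlinarith)

/-- The absorption `e^{−𝓛³⁰(log 2)²/2}·P₄⁸ ≤ exp(−𝓛¹⁰)` for `𝓛 ≥ 2`. [cite: Zhang2022LandauSiegel, §4 p.19] -/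
private theorem gauss_saving_le {D : ℕ} (hℓ : 2 ≤ ell D) :
    Real.exp (-(ell D ^ 30 * Real.log 2 ^ 2 / 2)) * P4 D ^ 8 ≤ Real.exp (-(ell D ^ 10)) := by
  have hℓ1 : 1 ≤ ell D := by linarith
  have hlog2 : 0.6931471803 < Real.log 2 := Real.log_two_gt_d9
  have hP4 := P4_le_exp hℓ1
  have hP40 : 0 ≤ P4 D := Typed.Section16ALeaves.P4_nonneg D
  have h8 : P4 D ^ 8 ≤ Real.exp (4160 * ell D ^ 9) := by
    calc P4 D ^ 8 ≤ Real.exp (520 * ell D ^ 9) ^ 8 := pow_le_pow_left₀ hP40 hP4 8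
      _ = Real.exp (4160 * ell D ^ 9) := by
          rw [← Real.exp_nat_mul]; congr 1; push_cast; ring
  have h20 : (2 : ℝ) ^ 20 ≤ ell D ^ 20 := pow_le_pow_left₀ (by norm_num) hℓ 20
  have h910 : ell D ^ 9 ≤ ell D ^ 10 := pow_le_pow_right₀ hℓ1 (by norm_num)
  have hmain : 4160 * ell D ^ 9 + ell D ^ 10 ≤ ell D ^ 30 * Real.log 2 ^ 2 / 2 := by
    have h30 : ell D ^ 30 = ell D ^ 10 * ell D ^ 20 := by ring
    have hl2 : (0.2 : ℝ) ≤ Real.log 2 ^ 2 / 2 := by nlinarith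
    have hpos10 : 0 ≤ ell D ^ 10 := by positivity
    have hA : ell D ^ 10 * 2 ^ 20 ≤ ell D ^ 10 * ell D ^ 20 :=
      mul_le_mul_of_nonneg_left h20 hpos10
    have hB : ell D ^ 10 * ell D ^ 20 * 0.2 ≤ ell D ^ 10 * ell D ^ 20 * (Real.log 2 ^ 2 / 2) :=
      mul_le_mul_of_nonneg_left hl2 (by positivity)
    rw [h30]
    linarith
  calc Real.exp (-(ell D ^ 30 * Real.log 2 ^ 2 / 2)) * P4 D ^ 8
      ≤ Real.exp (-(ell D ^ 30 * Real.log 2 ^ 2 / 2)) * Real.exp (4160 * ell D ^ 9) :=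
        mul_le_mul_of_nonneg_left h8 (Real.exp_pos _).le
    _ = Real.exp (-(ell D ^ 30 * Real.log 2 ^ 2 / 2) + 4160 * ell D ^ 9) := by rw [Real.exp_add]
    _ ≤ Real.exp (-(ell D ^ 10)) := Real.exp_le_exp.mpr (by linarith)

/-- `⌈e²⌉ ≤ D` gives `𝓛 = log D ≥ 2`. [cite: Zhang2022LandauSiegel, §2 p. 4] -/
private theorem two_le_ell_of_le {D : ℕ} (hD : ⌈Real.exp 2⌉₊ ≤ D) : 2 ≤ ell D := by
  have h : Real.exp 2 ≤ D := le_trans (Nat.le_ceil _) (by exact_mod_cast hD)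
  exact (Real.le_log_iff_exp_le (lt_of_lt_of_le (Real.exp_pos _) h)).mpr h

/-- **`Z22:(16.9)` DISCHARGED** (`c = 1`, `D ≥ ⌈e²⌉`, every `d, l ≥ 1`; (A) unused): `𝒟₂(d,l) =
λ₂(d)·(1/2πi)∫_{(1)} (Σ_n λ̃₂(n,d)ξ₂(n;d,l)n^{−1−s}) P₄^{s+β₂}d^{−s}ω₁(s+β₂)/(s+β₂) ds + O(ε)` — u020
(`step16_u020_holds`), the exact `ω₁`-Mellin identity (`integral_integrand16_9_eq_tsum`), and the
Gaussian tail `Σ_{dn ≥ 2P₄}` of the `g`-weighted series (`g* = g` on `(1/2,∞)`, `gWeight_le_gauss_tail`,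
`|λ̃₂ξ₂| ≤ τ⁶`, `|λ₂(d)| ≤ τ(d)²`), absorbed into `exp(−𝓛¹⁰)`. [cite: Zhang2022LandauSiegel, §16 (16.9) p.91] -/
theorem eq16_9_holds : Eq16_9 c' := by
  obtain ⟨K, hK⟩ : ∃ K : ℝ, K = ∑' n : ℕ, (n.divisors.card : ℝ) ^ 6 / (n : ℝ) ^ 9 := ⟨_, rfl⟩
  have hK0 : 0 ≤ K := by rw [hK]; exact tsum_nonneg fun n => by positivity
  refine ⟨1, one_pos, 1 / 2 * K, ⌈Real.exp 2⌉₊, fun D _ χ hD _ _ _ d l hd hl _ => ?_⟩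
  have hℓ : 2 ≤ ell D := two_le_ell_of_le hD
  have hℓ0 : 0 < ell D := by linarith
  have hd0 : d ≠ 0 := by omega
  have hdR : (0 : ℝ) < d := by exact_mod_cast Nat.pos_of_ne_zero hd0
  have hdR0 : (d : ℝ) ≠ 0 := hdR.ne'
  have hΛ : 0 < ell D ^ 30 := pow_pos hℓ0 30
  have hΛ24 : (24 : ℝ) ≤ ell D ^ 30 := by
    calc (24 : ℝ) ≤ 2 ^ 30 := by norm_num
      _ ≤ ell D ^ 30 := pow_le_pow_left₀ (by norm_num) hℓ 30
  have hP4 : 0 < P4 D := by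
    unfold P4 bigP bigT t0
    positivity
  have hβre : (beta2 c' D).re = 0 := by rw [beta2_eq_b2_mul_I]; simp
  -- the Gaussian saving
  obtain ⟨E, hE⟩ : ∃ E : ℝ, E = Real.exp (-(ell D ^ 30 * Real.log 2 ^ 2 / 2)) := ⟨_, rfl⟩
  have hE0 : 0 < E := by rw [hE]; exact Real.exp_pos _
  have hsave : E * P4 D ^ 8 ≤ Real.exp (-(ell D ^ 10)) := by rw [hE]; exact gauss_saving_le hℓ
  -- the terms: `M` (all `n`), `F` (the part `dn < 2P₄`), `T` (the tail `dn ≥ 2P₄`)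
  obtain ⟨M, hM⟩ : ∃ M : ℕ → ℂ, ∀ n, M n = lamTilde2 c' χ n d * xi2 c' χ n d l / n *
      (((d * n : ℕ) : ℂ) ^ beta2 c' D * (gW D (P4 D / ((d * n : ℕ) : ℝ)) : ℂ)) :=
    ⟨_, fun n => rfl⟩
  obtain ⟨F, hF⟩ : ∃ F : ℕ → ℂ, ∀ n, F n = if ((d * n : ℕ) : ℝ) < 2 * P4 D then M n else 0 :=
    ⟨_, fun n => rfl⟩
  obtain ⟨T, hT⟩ : ∃ T : ℕ → ℂ, ∀ n, T n = if ((d * n : ℕ) : ℝ) < 2 * P4 D then 0 else M n :=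
    ⟨_, fun n => rfl⟩
  have hM0 : M 0 = 0 := by rw [hM]; simp
  have hMFT : ∀ n, M n = F n + T n := fun n => by
    rw [hF, hT]; split_ifs <;> simp
  -- norms of the terms
  have hgW0 : ∀ y : ℝ, 0 ≤ gW D y := fun y => (GaussWeight.gWeight_pos hΛ y).le
  have hMn : ∀ n, n ≠ 0 →
      ‖M n‖ ≤ (n.divisors.card : ℝ) ^ 6 / n * gW D (P4 D / ((d * n : ℕ) : ℝ)) := by
    intro n hn
    have hnR : (0 : ℝ) < n := by exact_mod_cast Nat.pos_of_ne_zero hn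
    have hcpow : ‖((d * n : ℕ) : ℂ) ^ beta2 c' D‖ = 1 := by
      rw [Complex.norm_natCast_cpow_of_pos (Nat.pos_of_ne_zero (Nat.mul_ne_zero hd0 hn)), hβre,
        Real.rpow_zero]
    rw [hM, norm_mul, norm_mul, norm_div, hcpow, one_mul, Complex.norm_real, Complex.norm_natCast,
      Real.norm_of_nonneg (hgW0 _)]
    exact mul_le_mul_of_nonneg_right (div_le_div_of_nonneg_right
      (Typed.Section16ACalM2.norm_lamTilde2_mul_xi2_le c' χ hn d l) hnR.le) (hgW0 _)
  -- the tail majorant `‖T n‖ ≤ ½E(P₄⁸/d⁸)·τ(n)⁶/n⁹`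
  have hTn : ∀ n, ‖T n‖ ≤ 1 / 2 * E * (P4 D ^ 8 / (d : ℝ) ^ 8) *
      ((n.divisors.card : ℝ) ^ 6 / (n : ℝ) ^ 9) := by
    intro n
    have hnn : 0 ≤ 1 / 2 * E * (P4 D ^ 8 / (d : ℝ) ^ 8) *
        ((n.divisors.card : ℝ) ^ 6 / (n : ℝ) ^ 9) :=
      mul_nonneg (mul_nonneg (mul_nonneg (by norm_num) hE0.le)
        (div_nonneg (pow_nonneg hP4.le 8) (pow_nonneg (Nat.cast_nonneg d) 8)))
        (div_nonneg (pow_nonneg (Nat.cast_nonneg _) 6) (pow_nonneg (Nat.cast_nonneg _) 9))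
    rw [hT]
    split_ifs with hlt
    · rw [norm_zero]; exact hnn
    · rcases eq_or_ne n 0 with rfl | hn
      · rw [hM0, norm_zero]; exact hnn
      have hnR : (0 : ℝ) < n := by exact_mod_cast Nat.pos_of_ne_zero hn
      have hdn : (0 : ℝ) < ((d * n : ℕ) : ℝ) := by positivity
      rw [not_lt] at hlt
      have hx0 : 0 < P4 D / ((d * n : ℕ) : ℝ) := div_pos hP4 hdn
      have hx2 : P4 D / ((d * n : ℕ) : ℝ) ≤ 1 / 2 := by
        rw [div_le_iff₀ hdn]; linarith
      have hg : gW D (P4 D / ((d * n : ℕ) : ℝ)) ≤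
          1 / 2 * E * (P4 D / ((d * n : ℕ) : ℝ)) ^ 8 := by
        rw [hE]; exact gWeight_le_gauss_tail hΛ24 hx0 hx2
      have hx8 : (P4 D / ((d * n : ℕ) : ℝ)) ^ 8 = P4 D ^ 8 / ((d : ℝ) ^ 8 * (n : ℝ) ^ 8) := by
        rw [div_pow]; push_cast; rw [mul_pow]
      calc ‖M n‖ ≤ (n.divisors.card : ℝ) ^ 6 / n * gW D (P4 D / ((d * n : ℕ) : ℝ)) := hMn n hn
        _ ≤ (n.divisors.card : ℝ) ^ 6 / n * (1 / 2 * E * (P4 D / ((d * n : ℕ) : ℝ)) ^ 8) :=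
            mul_le_mul_of_nonneg_left hg (div_nonneg (pow_nonneg (Nat.cast_nonneg _) 6) hnR.le)
        _ = 1 / 2 * E * (P4 D ^ 8 / (d : ℝ) ^ 8) * ((n.divisors.card : ℝ) ^ 6 / (n : ℝ) ^ 9) := by
            rw [hx8]
            ring
  have hTs : Summable T :=
    Summable.of_norm_bounded (summable_tau6_div_pow9.mul_left _) hTn
  have hTnorm : ‖∑' n, T n‖ ≤ 1 / 2 * E * (P4 D ^ 8 / (d : ℝ) ^ 8) * K := by
    calc ‖∑' n, T n‖ ≤ ∑' n, ‖T n‖ := norm_tsum_le_tsum_norm hTs.norm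
      _ ≤ ∑' n : ℕ, 1 / 2 * E * (P4 D ^ 8 / (d : ℝ) ^ 8) *
            ((n.divisors.card : ℝ) ^ 6 / (n : ℝ) ^ 9) :=
          hTs.norm.tsum_le_tsum hTn (summable_tau6_div_pow9.mul_left _)
      _ = 1 / 2 * E * (P4 D ^ 8 / (d : ℝ) ^ 8) * K := by rw [tsum_mul_left, ← hK]
  -- the finite part: `F` is supported in `Icc 1 ⌊2P₄⌋`
  have hFsupp : ∀ n ∉ Finset.Icc 1 ⌊2 * P4 D⌋₊, F n = 0 := by
    intro n hn
    rw [hF]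
    rcases eq_or_ne n 0 with rfl | h0
    · simp [hM0]
    · have hNn : ⌊2 * P4 D⌋₊ < n := by
        by_contra hle
        exact hn (Finset.mem_Icc.mpr ⟨Nat.one_le_iff_ne_zero.mpr h0, not_lt.mp hle⟩)
      have hn2 : 2 * P4 D < n :=
        lt_of_lt_of_le (Nat.lt_floor_add_one _) (by exact_mod_cast hNn)
      have hdn : ¬ ((d * n : ℕ) : ℝ) < 2 * P4 D := by
        rw [not_lt]
        push_cast
        calc 2 * P4 D ≤ n := hn2.le
          _ ≤ (d : ℝ) * n := le_mul_of_one_le_left (Nat.cast_nonneg _)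
              (by exact_mod_cast Nat.pos_of_ne_zero hd0)
      rw [if_neg hdn]
  have hFs : Summable F := summable_of_ne_finset_zero hFsupp
  -- u020: `𝒟₂ = λ₂(d)·Σ_{n ≤ 2P₄} λ̃₂ξ₂ g̃₂(dn)/n`, and that finite sum is `Σ' F`
  have h020 := Typed.Section16ALeaves.step16_u020_holds c' D χ d l hd hl
  have hfin : (∑ n ∈ Finset.Icc 1 ⌊2 * P4 D⌋₊, lamTilde2 c' χ n d * xi2 c' χ n d l *
        gTilde16 c' D ((d * n : ℕ) : ℝ) / (n : ℂ)) = ∑' n, F n := by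
    rw [tsum_eq_sum hFsupp]
    refine Finset.sum_congr rfl fun n hn => ?_
    have hn1 : 1 ≤ n := (Finset.mem_Icc.mp hn).1
    have hdn : (0 : ℝ) < ((d * n : ℕ) : ℝ) := by
      have : 0 < d * n := Nat.mul_pos (Nat.pos_of_ne_zero hd0) hn1
      exact_mod_cast this
    rw [hF]
    by_cases hlt : ((d * n : ℕ) : ℝ) < 2 * P4 D
    · rw [if_pos hlt, hM, gTilde16, gstar, if_pos (by rw [lt_div_iff₀ hdn]; linarith),
        Complex.ofReal_natCast]
      ring
    · rw [if_neg hlt, gTilde16, gstar, if_neg (by rw [not_lt, div_le_iff₀ hdn]; linarith)]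
      simp
  -- the main term is `Σ' M`
  have hmain : (1 / (2 * π) : ℂ) * ∫ t : ℝ, integrand16_9 c' χ d l (1 + t * I) = ∑' n, M n := by
    rw [integral_integrand16_9_eq_tsum c' χ hd0 l hℓ0]
    exact tsum_congr fun n => (hM n).symm
  have hdiff : (∑' n, F n) - (∑' n, M n) = -∑' n, T n := by
    rw [show (∑' n, M n) = ∑' n, (F n + T n) from tsum_congr hMFT, hFs.tsum_add hTs]
    ring
  have hlam : ‖lam2 c' χ d 1‖ ≤ (d : ℝ) ^ 8 := by
    have hτ : (d.divisors.card : ℝ) ≤ d := by exact_mod_cast Nat.card_divisors_le_self d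
    calc ‖lam2 c' χ d 1‖ ≤ (d.divisors.card : ℝ) ^ 2 := norm_lam2_one_le c' χ hd0
      _ ≤ (d : ℝ) ^ 2 := pow_le_pow_left₀ (Nat.cast_nonneg _) hτ 2
      _ ≤ (d : ℝ) ^ 8 :=
          pow_le_pow_right₀ (by exact_mod_cast Nat.pos_of_ne_zero hd0) (by norm_num)
  -- assemble
  rw [h020, hfin, hmain, ← mul_sub, norm_mul, hdiff, norm_neg]
  calc ‖lam2 c' χ d 1‖ * ‖∑' n, T n‖
      ≤ (d : ℝ) ^ 8 * (1 / 2 * E * (P4 D ^ 8 / (d : ℝ) ^ 8) * K) :=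
        mul_le_mul hlam hTnorm (norm_nonneg _) (by positivity)
    _ = 1 / 2 * K * (E * P4 D ^ 8) := by
        field_simp
    _ ≤ 1 / 2 * K * Real.exp (-(ell D ^ 10)) := mul_le_mul_of_nonneg_left hsave (by positivity)
    _ = 1 / 2 * K * Real.exp (-1 * ell D ^ 10) := by rw [neg_one_mul]

/-- `Eq16_9` — `_holds` alias of `eq16_9_holds` above under the fact's exact name (appended
2026-08-28, D-0026 bookkeeping: the proof term is the existing theorem of this file; no statement,
definition or attribute is edited; no new named fact; the ledger's debt table listed the fact
unproved). [cite: Zhang2022LandauSiegel, §16 (16.9) p.91] -/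
theorem _root_.Literature.NumberTheory.LFunctions.Zhang2022.Typed.Section16A.Eq16_9_holds :
    Eq16_9 c' :=
  _root_.Literature.NumberTheory.LFunctions.Zhang2022.Typed.Section16A.eq16_9_holds (c' := c')


/-- **`Z22:§16.u023` DISCHARGED**: `𝒟₂(d,l) = λ₂(d)·(1/2πi)∫_{(1)} ζ(1+s+β₁)ℳ₂(d,l;1+s)/(ζ(1+s)L(1+s,χ))
· P₄^{s+β₂}d^{−s}ω₁(s+β₂)/(s+β₂) ds + O(ε)` — (16.9) and u021. [cite: Zhang2022LandauSiegel, §16 p.92 (u023)] -/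
theorem step16_u023_holds : Step16_u023 c' := step16_u023_of_eq16_9 c' (eq16_9_holds c')

/-- `Step16_u023` — `_holds` alias of `step16_u023_holds` above under the fact's exact name (appended
2026-08-28, D-0026 bookkeeping: the proof term is the existing theorem of this file; no statement,
definition or attribute is edited; no new named fact; the ledger's debt table listed the fact
unproved). [cite: Zhang2022LandauSiegel, §16 p.92 (u023)] -/
theorem _root_.Literature.NumberTheory.LFunctions.Zhang2022.Typed.Section16A.Step16_u023_holds :
    Step16_u023 c' :=
  _root_.Literature.NumberTheory.LFunctions.Zhang2022.Typed.Section16A.step16_u023_holds (c' := c')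

end Eq169

end Literature.NumberTheory.LFunctions.Zhang2022.Typed.Section16A
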